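import Summits.PneNP.PneNP.Theorems.ChebyshevTracialDesignTightLinks
import HarnessLib

/-!
# Cell pnp-psdrank, route `ChebyshevTracialDesign`: ANY TWO PERFECT MATCHINGS HAVE A COMMON TIGHT CUT OF EVERY ODD SIZE
# (crux `TracialDecayExp20`, stmt-PneNP-19878)

Brick 74 (prover g13; MEMO-16 §5/§6). A structural fact about the tight graph `cc(U,M) = |δ(U) ∩ M| = 1` used by the 'loyalty' step of the exact
orthogonal-labelling analysis (MEMO-16 §5: two matchings whose tight neighbourhoods lie in DISJOINT cut classes cannot exist): for every two perfect
matchings `M, M'` of a vertex set `Ω` and every odd `t ≤ |Ω| − 1` there is a `t`-set `U ⊆ Ω` tight for both, `cc(U,M) = cc(U,M') = 1`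
(`exists_common_tight`); i.e. `T(M) ∩ T(M') ∩ {|U| = t} ≠ ∅` — the matching side of the tight graph has 'diameter two' at every cut size.
The proof is an induction on `t` driven only by brick 71's `±1` law (no alternating-cycle decomposition): from a common tight `U` with crossing edges
`{a,b} ∈ M`, `{a',b'} ∈ M'` (`b, b' ∉ U`), either `b = b'` and `U + b + c` is common tight for any fresh `c`, or `b ≠ b'` and `U + b + d` is, where
`d` is the `M'`-partner of `b` (the uniqueness of the crossing edges places `d` and the `M`-partner of `d` outside `U + b`).
§1 generic vertex type; §2 the kernel's currency (`OddSet n`, `PMatch n`, `cc`). [cite: Rothvoss2017, §2 (PDF pp. 5–6: `δ(U)`, `|δ(U) ∩ M|`, `Q_1`)]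
Stature: support/instrument (elementary combinatorics). WHAT THIS IS NOT: nothing on values or psd rank of P_PM(K_n), no P-vs-NP content.
-/

set_option linter.dupNamespace false -- `Summit.PneNP.PneNP.…`: summit = sub-problem (D-0017)

noncomputable section

namespace Summit.PneNP.PneNP.Theorems.ChebyshevTracialDesignCommonTightCut

open Finset Literature.Barriers.PneNP
open Literature.Combinatorics.SimpleGraph.CycleSpace
open Literature.Combinatorics.AssociationSchemes.CutMatchingRestriction
open Summit.PneNP.PneNP.Theorems.ChebyshevTracialDesignTightLinks

/-! ### §1 Generic vertex type -/

section Generic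

variable {α : Type*} [DecidableEq α]

/-- Nothing crosses the empty set. -/
theorem crossCount_empty (M : Finset (Sym2 α)) : crossCount (∅ : Finset α) M = 0 := by
  unfold crossCount
  rw [card_eq_zero, filter_eq_empty_iff]
  intro e _
  induction e using Sym2.ind with
  | h x y => simp [crosses_mk]

/-- A single vertex is tight for every perfect matching: `cc({a}, M) = 1`. [cite: Rothvoss2017, §2 (PDF p. 6: the tight pairs `Q_1`)] -/
theorem crossCount_singleton {Ω : Finset α} {M : Finset (Sym2 α)} (hM : IsPMOn Ω M) {a : α} (ha : a ∈ Ω) :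
    crossCount ({a} : Finset α) M = 1 := by
  have h := crossCount_insert_eq_one_of_zero hM ha (W := ∅) (notMem_empty a) (crossCount_empty M)
  rwa [insert_empty_eq] at h

/-- **Uniqueness of the crossing edge**: if `cc(U, M) = 1` then any two edges of `M` crossing `U` coincide. -/
theorem crossing_edge_unique {U : Finset α} {M : Finset (Sym2 α)} (h1 : crossCount U M = 1) {e e' : Sym2 α} (he : e ∈ M)
    (hce : Crosses U e) (he' : e' ∈ M) (hce' : Crosses U e') : e = e' := by
  obtain ⟨f, hf⟩ := card_eq_one.1 h1
  have h : e ∈ M.filter (Crosses U) := mem_filter.2 ⟨he, hce⟩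
  have h' : e' ∈ M.filter (Crosses U) := mem_filter.2 ⟨he', hce'⟩
  rw [hf, mem_singleton] at h h'
  rw [h, h']

/-- **The induction step.** From a common tight set `U` (`cc(U,M) = cc(U,M') = 1`) with `|U| + 3 ≤ |Ω|` one gets a common tight set of size
`|U| + 2`. [cite: Rothvoss2017, §2 (PDF p. 6: the tight pairs `Q_1`)] -/
theorem exists_common_tight_step {Ω U : Finset α} {M M' : Finset (Sym2 α)} (hM : IsPMOn Ω M) (hM' : IsPMOn Ω M') (hU : U ⊆ Ω)
    (hcard : U.card + 3 ≤ Ω.card) (h1 : crossCount U M = 1) (h1' : crossCount U M' = 1) :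
    ∃ U', U' ⊆ Ω ∧ U'.card = U.card + 2 ∧ crossCount U' M = 1 ∧ crossCount U' M' = 1 := by
  obtain ⟨a, b, hab, ha, hb⟩ := exists_crossing_edge_of_one h1
  obtain ⟨a', b', hab', ha', hb'⟩ := exists_crossing_edge_of_one h1'
  have hbΩ : b ∈ Ω := hM.mem_of_mem hab (Sym2.mem_mk_right a b)
  -- `W = U + b` is split by `M`
  have hW0 : crossCount (insert b U) M = 0 := crossCount_insert_eq_zero_of_one hM hab ha hb h1
  have hWΩ : insert b U ⊆ Ω := insert_subset hbΩ hU
  have hWcard : (insert b U).card = U.card + 1 := card_insert_of_notMem hb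
  by_cases hbb : b = b'
  · -- both crossing edges end at `b`: `U + b` is split by both, add any fresh vertex
    subst hbb
    have hW0' : crossCount (insert b U) M' = 0 := crossCount_insert_eq_zero_of_one hM' hab' ha' hb' h1'
    have hlt : (insert b U).card < Ω.card := by omega
    obtain ⟨c, hcΩ, hcW⟩ := exists_mem_notMem_of_card_lt_card hlt
    refine ⟨insert c (insert b U), insert_subset hcΩ hWΩ, by rw [card_insert_of_notMem hcW, hWcard], ?_, ?_⟩
    · exact crossCount_insert_eq_one_of_zero hM hcΩ hcW hW0
    · exact crossCount_insert_eq_one_of_zero hM' hcΩ hcW hW0'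
  · -- `b ≠ b'`: let `d` be the `M'`-partner of `b`
    obtain ⟨f, hf, hbf⟩ := hM'.exists_mem hbΩ
    set d := Sym2.Mem.other hbf with hd
    have hbd : s(b, d) ∈ M' := by rw [hd, Sym2.other_spec hbf]; exact hf
    have hdb : d ≠ b := fun h => hM'.not_isDiag hbd (Sym2.mk_isDiag_iff.2 h.symm)
    have hdΩ : d ∈ Ω := hM'.mem_of_mem hbd (Sym2.mem_mk_right b d)
    -- `d ∉ U`: otherwise `{b, d}` would be the `M'`-crossing edge `{a', b'}`, forcing `b = b'`
    have hdU : d ∉ U := by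
      intro hdU
      have hcr : Crosses U s(b, d) := (crosses_mk U b d).2 (Or.inr ⟨hb, hdU⟩)
      have heq := crossing_edge_unique h1' hbd hcr hab' ((crosses_mk U a' b').2 (Or.inl ⟨ha', hb'⟩))
      rcases Sym2.eq_iff.1 heq with ⟨h1, _⟩ | ⟨h1, _⟩
      · exact hb (h1 ▸ ha')
      · exact hbb h1
    have hdW : d ∉ insert b U := by rw [mem_insert, not_or]; exact ⟨hdb, hdU⟩
    -- crossing counts of `W = U + b` and `U' = W + d` for `M'`
    have hW2 : crossCount (insert b U) M' = crossCount U M' + 1 := crossCount_insert_of_not_mem hM' hbd hb hdU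
    have hdb' : s(d, b) ∈ M' := by rw [Sym2.eq_swap]; exact hbd
    have hU'M' : crossCount (insert d (insert b U)) M' + 1 = crossCount (insert b U) M' :=
      crossCount_insert_of_mem hM' hdb' hdW (mem_insert_self b U)
    -- for `M`: the `M`-partner `m` of `d` is outside `W`
    obtain ⟨g, hg, hdg⟩ := hM.exists_mem hdΩ
    set m := Sym2.Mem.other hdg with hm
    have hdm : s(d, m) ∈ M := by rw [hm, Sym2.other_spec hdg]; exact hg
    have hmW : m ∉ insert b U := by
      rw [mem_insert, not_or]
      refine ⟨fun hmb => ?_, fun hmU => ?_⟩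
      · -- `m = b`: then `{d, b} ∈ M` and `{a, b} ∈ M` share `b`, so `d = a ∈ U`
        rw [hmb] at hdm
        have heq : s(d, b) = s(a, b) := hM.unique hdm hab (Sym2.mem_mk_right d b) (Sym2.mem_mk_right a b)
        rcases Sym2.eq_iff.1 heq with ⟨h1, _⟩ | ⟨h1, h2⟩
        · exact hdU (h1 ▸ ha)
        · exact hdb h1
      · -- `m ∈ U`: then `{d, m}` crosses `U`, so it is `{a, b}`, putting `d ∈ {a, b}`
        have hcr : Crosses U s(d, m) := (crosses_mk U d m).2 (Or.inr ⟨hdU, hmU⟩)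
        have heq := crossing_edge_unique h1 hdm hcr hab ((crosses_mk U a b).2 (Or.inl ⟨ha, hb⟩))
        rcases Sym2.eq_iff.1 heq with ⟨h1, _⟩ | ⟨h1, _⟩
        · exact hdU (h1 ▸ ha)
        · exact hdb h1
    have hU'M : crossCount (insert d (insert b U)) M = crossCount (insert b U) M + 1 :=
      crossCount_insert_of_not_mem hM hdm hdW hmW
    refine ⟨insert d (insert b U), insert_subset hdΩ hWΩ, by rw [card_insert_of_notMem hdW, hWcard], ?_, ?_⟩
    · rw [hU'M, hW0]
    · omega

/-- **COMMON TIGHT CUT.** For two perfect matchings `M, M'` of `Ω` and every `k` with `2k + 2 ≤ |Ω|` there is a `(2k+1)`-set `U ⊆ Ω` with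
`cc(U, M) = cc(U, M') = 1`. [cite: Rothvoss2017, §2 (PDF p. 6: the tight pairs `Q_1`)] -/
theorem exists_common_tight {Ω : Finset α} {M M' : Finset (Sym2 α)} (hM : IsPMOn Ω M) (hM' : IsPMOn Ω M') :
    ∀ k : ℕ, 2 * k + 2 ≤ Ω.card → ∃ U, U ⊆ Ω ∧ U.card = 2 * k + 1 ∧ crossCount U M = 1 ∧ crossCount U M' = 1 := by
  intro k
  induction k with
  | zero =>
    intro hk
    have hne : Ω.Nonempty := card_pos.1 (by omega)
    obtain ⟨a, ha⟩ := hne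
    exact ⟨{a}, singleton_subset_iff.2 ha, by simp, crossCount_singleton hM ha, crossCount_singleton hM' ha⟩
  | succ k ih =>
    intro hk
    obtain ⟨U, hUΩ, hUcard, h1, h1'⟩ := ih (by omega)
    obtain ⟨U', hU'Ω, hU'card, h, h'⟩ := exists_common_tight_step hM hM' hUΩ (by omega) h1 h1'
    exact ⟨U', hU'Ω, by omega, h, h'⟩

end Generic

/-! ### §2 The kernel's currency -/

section Cuts

variable {n : ℕ}

/-- **Common tight `t`-cut in `K_n`.** For every odd `t` with `t + 1 ≤ n` and any two perfect matchings `M, M'` of `K_n` there is a `t`-cut `U` with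
`cc U M = 1` and `cc U M' = 1`: the tight neighbourhoods `T(M) = {U : |U| = t, cc(U,M) = 1}` of any two matchings intersect.
[cite: Rothvoss2017, §2 (PDF p. 6: the tight pairs `Q_1`)] -/
theorem exists_common_tight_cut {t : ℕ} (ht : Odd t) (htn : t + 1 ≤ n) (M M' : PMatch n) :
    ∃ U : OddSet n, U.1.card = t ∧ cc U M = 1 ∧ cc U M' = 1 := by
  obtain ⟨k, hk⟩ := ht
  obtain ⟨U, -, hUcard, h, h'⟩ := exists_common_tight M.2 M'.2 k (by rw [card_univ, Fintype.card_fin]; omega)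
  refine ⟨⟨U, by rw [hUcard]; exact ⟨k, rfl⟩⟩, by rw [hUcard, hk], ?_, ?_⟩
  · rw [cc_eq_crossCount]; exact h
  · rw [cc_eq_crossCount]; exact h'

/-- Equivalently: no two matchings have DISJOINT tight neighbourhoods at cut size `t` — for any two families of `t`-cuts `A ⊇ T(M)`, `A' ⊇ T(M')`,
`A ∩ A' ≠ ∅`. In the orthogonal-labelling language (MEMO-16 §5): two matchings cannot be 'loyal' to disjoint cut classes.
[cite: Rothvoss2017, §2 (PDF p. 6: the tight pairs `Q_1`)] -/
theorem not_disjoint_of_tight_subset {t : ℕ} (ht : Odd t) (htn : t + 1 ≤ n) (M M' : PMatch n) {A A' : Finset (OddSet n)}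
    (hA : ∀ U : OddSet n, U.1.card = t → cc U M = 1 → U ∈ A) (hA' : ∀ U : OddSet n, U.1.card = t → cc U M' = 1 → U ∈ A') :
    ¬ Disjoint A A' := by
  obtain ⟨U, hUt, h, h'⟩ := exists_common_tight_cut ht htn M M'
  exact fun hd => disjoint_left.1 hd (hA U hUt h) (hA' U hUt h')

end Cuts

end Summit.PneNP.PneNP.Theorems.ChebyshevTracialDesignCommonTightCut
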